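import Summits.QuantumFields.BalabanUV.T4Continuum.Support.NE7EJFlatSecular

/-!
# NE7EJFlatSecularMax — row NE7 (node U5), candidate route HOM, variant H1L-EJ, item EJ-1b′ (T1)–(T3′): lens 1's LANDSCAPE remark in kernel — the
# admissible set of flat weights is NOT closed under the pointwise maximum of inverse weights: `max(1∕g_hh, 1∕g_B)` FAILS the secular criterion at
# the axis momentum `p = (π∕3, 0)` with the exact value `169∕160` («1.056 > 1, pairing u = ¼, ¾»)

Lineage `b2b-balaban-t4-ne7-p2` (CRUX PROVER NE7 #2 = C-HOM°'s kernel hand), generation 82; file 132.  Imports file 117 `NE7EJFlatSecular` only (`G`, `uu`,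
`ww`, `sum_alias`).

SOURCE (lens 1 = `t4-ne7-idea-1` gen 73, toy P-EJ-15 (iii), `t4/ideate/NE7/lens1-g73/FLATPADE-NOTE.md` d2ccf99438315edd; [NE7IDEA1-G73-INBOX] L.53664):
«LANDSCAPE: admissible weights h = 1∕g form a convex set; (hh) and B are distinct axis-saturating extreme directions, neither implies the other,
max(φ_hh, φ_B) NOT admissible (1.056 > 1 pairing u = ¼, ¾)»; d = 2, L = 2 FLAT abelian toy — «never the NE7 estimate».  Convexity is file 130
(`admissible_interp`); «neither implies the other» is file 127 (`psiHH_sub_psiB`); THIS FILE is the last clause.  In file 117's variables the inverse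
weights are `1∕g_hh(4u) = 1∕G(u)` ((hh), file 117) and `1∕g_B(4u) = 1 + 2u` (THEOREM B, files 127–128); the profile `max(φ_hh, φ_B)` has inverse weight
`h_max(u) = max(1∕G(u), 1 + 2u)`, and its secular sum at `(y₁, y₂) = (¼, 0)` — the AXIS momentum `p = (π∕3, 0)`, where the two surviving alias labels
have `u = ¼` (weight `(¾)² = 9∕16`, `h_max = 8∕5` from (hh)) and `u = ¾` (weight `(¼)² = 1∕16`, `h_max = 5∕2` from B) — is `9∕16·8∕5 + 1∕16·5∕2 = 169∕160 > 1`.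
* `hMax`, `hMax_eq_hh_iff` (`1∕G(u) ≥ 1 + 2u ↔ u ≤ ½` on `u ≥ 0`: (hh) wins at low, B at high alias energy), **`secular_max_witness`** (`= 169∕160`),
  **`one_lt_secular_max_witness`**, and the momentum form `secular_max_witness_trig` (`y₁ = sin²(π∕6) = ¼`).
So no single admissible weight dominates both (hh) and B: the flat master inequalities of files 125 (hh) and 131 (B) are two genuinely different
extreme statements, exactly as lens 1 says.

HONEST FRAMING: [folklore] exact rational arithmetic at one point; lens 1's objects and the reading stay hers; nothing of Bałaban's instantiated; d = 2 flat
toy; NOT a letter move (PRICING-NE7 v56 §413); T-50-10 honoured.  NE7 NOT PRINTED ∕ NOT PROVED; spine 0∕9; FIXED FINITE T⁴, rung (B)+1; NOT infinite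
volume, NOT mass gap, NOT Clay.  HONEST DEPENDENCY: continuum YM on T⁴ ⇐ BetaPertH ∧ nine spine estimates (0/9 proved); BetaPertH ⇐ (D1) ∧ (D4) ∧
CAP+tail; G-an2-4 gates asym, D1 and NE2/3/4.
-/

noncomputable section

open Finset Real

namespace Summit.QuantumFields.BalabanUV.T4Continuum.NE7EJFlatSecularMax

open NE7EJFlatSecular

/-- the inverse weight of the profile `max(φ_hh, φ_B)`: `h_max(u) := max(1∕G(u), 1 + 2u)` at alias energy `ω = 4u`. [folklore] -/
def hMax (u : ℝ) : ℝ := max (1 / G u) (1 + 2 * u)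

/-- `(1 + 2u)·G(u) = 1 − 2u² + 4u³`: so `1∕G(u) ≥ 1 + 2u` exactly when `u ≤ ½` (for `u ≥ 0`). [folklore] -/
theorem one_add_two_mul_mul_G (u : ℝ) : (1 + 2 * u) * G u = 1 - 2 * u ^ 2 + 4 * u ^ 3 := by unfold G; ring

/-- (hh) wins below `u = ½`, B above: for `u ≥ 0`, `1 + 2u ≤ 1∕G(u) ↔ u ≤ ½`. [folklore] -/
theorem hMax_eq_hh_iff {u : ℝ} (hu : 0 ≤ u) : 1 + 2 * u ≤ 1 / G u ↔ u ≤ 1 / 2 := by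
  rw [le_div_iff₀ (G_pos u), one_add_two_mul_mul_G]
  constructor
  · intro h
    by_contra hc
    have hc' : 1 / 2 < u := not_le.mp hc
    have : 2 * u ^ 2 < 4 * u ^ 3 := by nlinarith [mul_pos (by linarith : (0:ℝ) < u) (by linarith : (0:ℝ) < u)]
    linarith
  · intro h
    nlinarith [mul_nonneg hu hu, mul_nonneg (mul_nonneg hu hu) (by linarith : (0:ℝ) ≤ 1 / 2 - u)]

/-- **LENS 1's MAX-WITNESS, EXACTLY**: at `(y₁, y₂) = (¼, 0)` the secular sum of `h_max` is `Σ_n w_n·h_max(u_n) = 169∕160`. [folklore] -/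
theorem secular_max_witness : ∑ n, ww (1 / 4) 0 n * hMax (uu (1 / 4) 0 n) = 169 / 160 := by
  rw [sum_alias]; unfold ww uu hMax G
  simp only [Bool.false_eq_true, ↓reduceIte]
  norm_num [max_def]

/-- hence `> 1`: the weight `min(g_hh, g_B)` (profile `max(φ_hh, φ_B)`) is NOT admissible — the admissible set is convex (file 130) but not a lattice.
[folklore] -/
theorem one_lt_secular_max_witness : 1 < ∑ n, ww (1 / 4) 0 n * hMax (uu (1 / 4) 0 n) := by
  rw [secular_max_witness]; norm_num

/-- the same at the momentum `p = (π∕3, 0)`: `sin²(π∕6) = ¼`, `sin²(0) = 0`. [folklore] -/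
theorem secular_max_witness_trig : 1 < ∑ n, ww (sin ((π / 3) / 2) ^ 2) (sin ((0:ℝ) / 2) ^ 2) n * hMax (uu (sin ((π / 3) / 2) ^ 2) (sin ((0:ℝ) / 2) ^ 2) n) := by
  have h1 : sin ((π / 3) / 2) ^ 2 = 1 / 4 := by
    rw [show (π / 3) / 2 = π / 6 by ring, sin_pi_div_six]; norm_num
  have h2 : sin ((0:ℝ) / 2) ^ 2 = 0 := by simp
  rw [h1, h2]; exact one_lt_secular_max_witness

/-- for contrast, each inverse weight alone passes at this point: `Σ_n w_n∕G(u_n) = 1` ((hh), file 117's axis identity) … [folklore] -/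
theorem hh_at_witness : secularS (1 / 4) 0 = 1 := secularS_axis _

/-- … and `Σ_n w_n(1 + 2u_n) = 1` (B; the axis case of file 128's `S_B = 1 − 4AB`, here `B = 0`), computed directly. [folklore] -/
theorem B_at_witness : ∑ n, ww (1 / 4) 0 n * (1 + 2 * uu (1 / 4) 0 n) = 1 := by
  rw [sum_alias]; unfold ww uu; simp only [Bool.false_eq_true, ↓reduceIte]; norm_num

end Summit.QuantumFields.BalabanUV.T4Continuum.NE7EJFlatSecularMax

end
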